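import Literature.Analysis.FluidPDE.Seregin2023.PolynomialScenarioExcluded
import Literature.Analysis.FluidPDE.ClassicalSuitable
import Literature.Analysis.FluidPDE.LocalTypeIProofs
import HarnessLib

/-!
# Seregin 2026, Thm 2.1 as typed WITHOUT continuity of the weight is false: a counterexample

Analysis/FluidPDE proof-only file (theorems and private plumbing definitions; no named fact). The
named fact `Literature.Analysis.FluidPDE.Seregin2023.seregin2026_typeII_scenario_excluded`
(`TypeIIEulerZoomScenario.lean`; G. Seregin, arXiv:2606.29468 (2026) [`Seregin2026`], Thm 2.1)
renders the scenario weight `f` by `IsScenarioWeight f F` — strictly increasing on `]0,1]`, values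
in `]0,1]`, `f(1) = 1`, `f(0+) = 0`, positive limit ratio `F(a) = liminf_{λ→0} f(λa)/f(λ)` — which is
faithful to the printed words ("monotonically increasing", p. 4, (2.2) p. 5) but carries NO
continuity, whereas the printed proof (p. 6: "the choice of `λ` is as follows: `λ = λ_k`,
`r_k = λ_k √(f(λ_k))`") inverts `φ(λ) = λ√f(λ)`. The growth relation (2.4) constrains the rate `g`
only on the range of `φ`; a jumpy weight leaves gaps in that range accumulating at `0`, on which
`g` is free, and the conclusion (2.5) `g(r) M^{s,l}_κ(v,r) → 0` (over ALL `r → 0⁺`) fails.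

This file proves, sorry-free, `¬ seregin2026_typeII_scenario_excluded`
(`not_seregin2026_typeII_scenario_excluded`), written against the def and also written out in full
(`exists_scenario_hypotheses_not_tendsto`) so that the refutation survives a retirement of the def.
The corrected statement — the same sentence with `f` continuous on `]0,1]` — is PROVED in
`TypeIIScenarioExcluded.lean` (`seregin2026_typeII_scenario_excluded_continuousWeight_holds`), and
its consequences in `TypeIIScenarioExcludedConsequences.lean`.

## The example (`namespace TypeIIScenarioCounterexample`)

* the flow: `v ≡ c` (a unit vector), `q ≡ 0`, `G ≡ 0` — a classical, hence suitable, solution in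
  `Q(0,1)` (`isSuitableWeakSolutionInBall_const`), with `A_f(v,r) = f(r)² r² |B₁| ≤ |B₁|`,
  `E_f = D_f = 0` (`hasWeightedEnergyBound_const`) and `M^{3,3}_2(v, r) = |B(0,r)|`
  (`morreyM_const`);
* the weight: `f(λ) = (λ + D(λ))/2`, `D(λ) = 2^{⌊log₂ λ⌋}` the dyadic floor (`dyadicFloor`,
  `weight`): strictly increasing, `3λ/4 < f(λ) ≤ λ`, `f(1) = 1`, `f(2^{-n}) = 2^{-n}` but
  `f(λ) < (3/4) 2^{-n}` for `λ < 2^{-n}` — a jump at every dyadic scale; it is a scenario weight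
  (`isScenarioWeight_weight`: the ratio `f(λa)/f(λ)` lies in `]3a/4, 4a/3[`, so its lower limit is
  a positive real `F(a)`);
* the gaps: `a_n = 2^{-n} √(3·2^{-n}/4)` is not of the form `λ√f(λ)`, `λ ∈ ]0,1]`
  (`zoomScale_ne_gap`);
* the rate: `g(λ√f(λ)) = f(λ)^{e+1}` on the range of `φ` (so (2.4) reads `f(λ)^{-1} → ∞`) and
  `g(r) = r^{-4}` off it (`badRate`); at the gaps `g(a_n) M^{3,3}_2(v, a_n) = |B₁| a_n^{-1} ≥ |B₁|`,
  so (2.5) fails; `(s, l, η) = (3, 3, 0)` (`κ = 2 < 3`, `3 < p(0) = q(0) = 10/3`).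

## References

* G. Seregin, arXiv:2606.29468 (2026), §1 p. 4, (2.2)–(2.5), Thm 2.1 (p. 5), proof p. 6. [`Seregin2026`]
-/

noncomputable section

open _root_.MeasureTheory _root_.Set _root_.Filter _root_.Metric _root_.Function
  _root_.TopologicalSpace
open scoped _root_.ENNReal _root_.NNReal _root_.Topology _root_.Laplacian

namespace Literature.Analysis.FluidPDE.Seregin2023

namespace TypeIIScenarioCounterexample

/-! ### The dyadic floor `D(λ) = 2^{⌊log₂ λ⌋}` -/

/-- The dyadic floor `D(λ) = 2^{⌊log₂ λ⌋}`: the largest integer power of `2` below `λ > 0`. [folklore] -/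
def dyadicFloor (lam : ℝ) : ℝ :=
  (2 : ℝ) ^ ⌊Real.logb 2 lam⌋

/-- `D(λ) > 0`. [folklore] -/
private theorem dyadicFloor_pos (lam : ℝ) : 0 < dyadicFloor lam :=
  zpow_pos two_pos _

/-- `D(λ) ≤ λ` (`λ > 0`). [folklore] -/
private theorem dyadicFloor_le {lam : ℝ} (hlam : 0 < lam) : dyadicFloor lam ≤ lam := by
  unfold dyadicFloor
  calc (2 : ℝ) ^ ⌊Real.logb 2 lam⌋ = (2 : ℝ) ^ ((⌊Real.logb 2 lam⌋ : ℤ) : ℝ) :=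
        (Real.rpow_intCast 2 _).symm
    _ ≤ (2 : ℝ) ^ Real.logb 2 lam :=
        Real.rpow_le_rpow_of_exponent_le one_le_two (Int.floor_le _)
    _ = lam := Real.rpow_logb two_pos (by norm_num) hlam

/-- `λ < 2 D(λ)` (`λ > 0`). [folklore] -/
private theorem lt_two_mul_dyadicFloor {lam : ℝ} (hlam : 0 < lam) : lam < 2 * dyadicFloor lam := by
  unfold dyadicFloor
  calc lam = (2 : ℝ) ^ Real.logb 2 lam := (Real.rpow_logb two_pos (by norm_num) hlam).symm
    _ < (2 : ℝ) ^ (((⌊Real.logb 2 lam⌋ + 1 : ℤ)) : ℝ) := by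
        refine Real.rpow_lt_rpow_of_exponent_lt one_lt_two ?_
        push_cast
        exact Int.lt_floor_add_one _
    _ = 2 * (2 : ℝ) ^ ⌊Real.logb 2 lam⌋ := by
        rw [Real.rpow_intCast, zpow_add_one₀ two_ne_zero, mul_comm]

/-- The dyadic floor is monotone on `]0, ∞[`. [folklore] -/
private theorem dyadicFloor_mono {lam mu : ℝ} (hlam : 0 < lam) (hle : lam ≤ mu) :
    dyadicFloor lam ≤ dyadicFloor mu := by
  unfold dyadicFloor
  exact zpow_le_zpow_right₀ one_le_two
    (Int.floor_le_floor (Real.logb_le_logb_of_le one_lt_two hlam hle))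

/-- `D(2^k) = 2^k` for integer `k`. [folklore] -/
private theorem dyadicFloor_zpow (k : ℤ) : dyadicFloor ((2 : ℝ) ^ k) = (2 : ℝ) ^ k := by
  unfold dyadicFloor
  have h : Real.logb 2 ((2 : ℝ) ^ k) = k := by
    rw [Real.logb, Real.log_zpow, mul_div_assoc, div_self (Real.log_pos one_lt_two).ne', mul_one]
  rw [h, Int.floor_intCast]

/-- Below a dyadic scale the dyadic floor drops by a factor `2`: `λ < 2^k ⟹ D(λ) ≤ 2^{k-1}`
(`λ > 0`). [folklore] -/
private theorem dyadicFloor_le_of_lt_zpow {lam : ℝ} (hlam : 0 < lam) {k : ℤ} (hlt : lam < (2 : ℝ) ^ k) :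
    dyadicFloor lam ≤ (2 : ℝ) ^ (k - 1) := by
  have h1 : (2 : ℝ) ^ ⌊Real.logb 2 lam⌋ < (2 : ℝ) ^ k :=
    lt_of_le_of_lt (dyadicFloor_le hlam) hlt
  have h2 : ⌊Real.logb 2 lam⌋ < k := (zpow_lt_zpow_iff_right₀ one_lt_two).1 h1
  unfold dyadicFloor
  exact zpow_le_zpow_right₀ one_le_two (by omega)

/-! ### The jumpy weight `f(λ) = (λ + D(λ))/2` -/

/-- The weight `f(λ) = (λ + 2^{⌊log₂ λ⌋})/2`: strictly increasing, `3λ/4 < f(λ) ≤ λ`, with a jump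
at every dyadic scale. [folklore] -/
def weight (lam : ℝ) : ℝ :=
  (lam + dyadicFloor lam) / 2

/-- `f(λ) > 0` for `λ > 0`. [folklore] -/
private theorem weight_pos {lam : ℝ} (hlam : 0 < lam) : 0 < weight lam := by
  unfold weight
  have := dyadicFloor_pos lam
  positivity

/-- `f(λ) ≤ λ` for `λ > 0`. [folklore] -/
private theorem weight_le_self {lam : ℝ} (hlam : 0 < lam) : weight lam ≤ lam := by
  unfold weight
  have := dyadicFloor_le hlam
  linarith

/-- `3λ/4 < f(λ)` for `λ > 0`. [folklore] -/
private theorem lt_weight {lam : ℝ} (hlam : 0 < lam) : 3 / 4 * lam < weight lam := by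
  unfold weight
  have := lt_two_mul_dyadicFloor hlam
  linarith

/-- `f` is strictly increasing on `]0, ∞[`. [folklore] -/
private theorem weight_strictMonoOn : StrictMonoOn weight (Ioi (0 : ℝ)) := by
  intro a ha b _ hab
  unfold weight
  have := dyadicFloor_mono ha hab.le
  linarith

/-- `f(2^k) = 2^k` for integer `k`. [folklore] -/
private theorem weight_zpow (k : ℤ) : weight ((2 : ℝ) ^ k) = (2 : ℝ) ^ k := by
  unfold weight
  rw [dyadicFloor_zpow]
  ring

/-- `f(1) = 1`. [folklore] -/
private theorem weight_one : weight 1 = 1 := by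
  simpa using weight_zpow 0

/-- The jump: below the dyadic scale `2^k` the weight stays below `(3/4) 2^k`. [folklore] -/
private theorem weight_lt_of_lt_zpow {lam : ℝ} (hlam : 0 < lam) {k : ℤ} (hlt : lam < (2 : ℝ) ^ k) :
    weight lam < 3 / 4 * (2 : ℝ) ^ k := by
  unfold weight
  have h1 := dyadicFloor_le_of_lt_zpow hlam hlt
  have h2 : (2 : ℝ) ^ (k - 1) = (2 : ℝ) ^ k / 2 := by
    rw [zpow_sub_one₀ two_ne_zero]; ring
  rw [h2] at h1
  linarith

/-- The ratio `f(λa)/f(λ)` lies in `]3a/4, 4a/3[` (`λ, a > 0`). [folklore] -/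
private theorem weight_ratio_bounds {lam a : ℝ} (hlam : 0 < lam) (ha : 0 < a) :
    3 / 4 * a < weight (lam * a) / weight lam ∧ weight (lam * a) / weight lam < 4 / 3 * a := by
  have hw : 0 < weight lam := weight_pos hlam
  have h1 := lt_weight (mul_pos hlam ha)
  have h2 := weight_le_self (mul_pos hlam ha)
  have h3 := lt_weight hlam
  have h4 := weight_le_self hlam
  constructor
  · rw [lt_div_iff₀ hw]; nlinarith
  · rw [div_lt_iff₀ hw]; nlinarith

/-- **The jumpy weight is a scenario weight in the typed sense** (`IsScenarioWeight`): with
`F(a)` the (finite, positive) lower limit of `f(λa)/f(λ)`. [cite: Seregin2026, §1 p. 4 and (2.2) (p. 5)] -/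
theorem isScenarioWeight_weight :
    IsScenarioWeight weight (fun a =>
      (liminf (fun lam => ENNReal.ofReal (weight (lam * a) / weight lam)) (𝓝[>] 0)).toReal) := by
  have hbd : ∀ a : ℝ, 0 < a →
      ENNReal.ofReal (3 / 4 * a) ≤
          liminf (fun lam => ENNReal.ofReal (weight (lam * a) / weight lam)) (𝓝[>] 0) ∧
        liminf (fun lam => ENNReal.ofReal (weight (lam * a) / weight lam)) (𝓝[>] 0) ≤
          ENNReal.ofReal (4 / 3 * a) := by
    intro a ha
    have hev : ∀ᶠ lam in 𝓝[>] (0 : ℝ),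
        ENNReal.ofReal (3 / 4 * a) ≤ ENNReal.ofReal (weight (lam * a) / weight lam) ∧
          ENNReal.ofReal (weight (lam * a) / weight lam) ≤ ENNReal.ofReal (4 / 3 * a) := by
      filter_upwards [self_mem_nhdsWithin] with lam hlam
      have hb := weight_ratio_bounds (a := a) hlam ha
      exact ⟨ENNReal.ofReal_le_ofReal hb.1.le, ENNReal.ofReal_le_ofReal hb.2.le⟩
    exact ⟨le_liminf_of_le (by isBoundedDefault) (hev.mono fun _ h => h.1),
      liminf_le_of_frequently_le (hev.mono fun _ h => h.2).frequently (by isBoundedDefault)⟩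
  refine ⟨weight_strictMonoOn.mono fun x hx => hx.1, fun r hr => ⟨weight_pos hr.1,
    (weight_le_self hr.1).trans hr.2⟩, weight_one, ?_, fun a ha => ?_, fun a ha => ?_⟩
  · -- `f(λ) → 0⁺` (squeezed between `0` and `λ`)
    refine tendsto_of_tendsto_of_tendsto_of_le_of_le' tendsto_const_nhds
      (tendsto_nhdsWithin_of_tendsto_nhds tendsto_id) ?_ ?_
    · filter_upwards [self_mem_nhdsWithin] with lam hlam using (weight_pos hlam).le
    · filter_upwards [self_mem_nhdsWithin] with lam hlam using weight_le_self hlam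
  · obtain ⟨h1, h2⟩ := hbd a ha
    have htop : liminf (fun lam => ENNReal.ofReal (weight (lam * a) / weight lam)) (𝓝[>] 0) ≠ ⊤ :=
      ne_top_of_le_ne_top ENNReal.ofReal_ne_top h2
    have hpos : 0 < ENNReal.ofReal (3 / 4 * a) := ENNReal.ofReal_pos.2 (by positivity)
    exact ENNReal.toReal_pos (hpos.trans_le h1).ne' htop
  · obtain ⟨-, h2⟩ := hbd a ha
    have htop : liminf (fun lam => ENNReal.ofReal (weight (lam * a) / weight lam)) (𝓝[>] 0) ≠ ⊤ :=
      ne_top_of_le_ne_top ENNReal.ofReal_ne_top h2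
    rw [ENNReal.ofReal_toReal htop]

/-! ### The zoom scale `φ(λ) = λ√f(λ)` and its gaps -/

/-- The zoom scale `φ(λ) = λ √(f(λ))` of [Seregin2026] p. 6 for the jumpy weight. [folklore] -/
def zoomScale (lam : ℝ) : ℝ :=
  lam * Real.sqrt (weight lam)

/-- `φ(λ) > 0` for `λ > 0`. [folklore] -/
private theorem zoomScale_pos {lam : ℝ} (hlam : 0 < lam) : 0 < zoomScale lam :=
  mul_pos hlam (Real.sqrt_pos.2 (weight_pos hlam))

/-- `φ` is strictly increasing on `]0, ∞[`. [folklore] -/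
private theorem zoomScale_strictMonoOn : StrictMonoOn zoomScale (Ioi (0 : ℝ)) := by
  intro a ha b hb hab
  unfold zoomScale
  have h1 : Real.sqrt (weight a) ≤ Real.sqrt (weight b) :=
    Real.sqrt_le_sqrt (weight_strictMonoOn ha hb hab).le
  have h2 : 0 < Real.sqrt (weight a) := Real.sqrt_pos.2 (weight_pos ha)
  calc a * Real.sqrt (weight a) < b * Real.sqrt (weight a) := mul_lt_mul_of_pos_right hab h2
    _ ≤ b * Real.sqrt (weight b) := mul_le_mul_of_nonneg_left h1 (le_of_lt hb)

/-- The gap radii `a_k = 2^k √(3·2^k/4)`. [folklore] -/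
def gapRadius (k : ℤ) : ℝ :=
  (2 : ℝ) ^ k * Real.sqrt (3 / 4 * (2 : ℝ) ^ k)

/-- `a_k > 0`. [folklore] -/
private theorem gapRadius_pos (k : ℤ) : 0 < gapRadius k :=
  mul_pos (zpow_pos two_pos _) (Real.sqrt_pos.2 (by positivity))

/-- **The gaps of the range of `φ`**: no `λ > 0` has `λ√f(λ) = a_k` (below `2^k` the weight is
`< (3/4)2^k`, from `2^k` on it is `≥ 2^k`). [folklore] -/
private theorem zoomScale_ne_gapRadius {lam : ℝ} (hlam : 0 < lam) (k : ℤ) : zoomScale lam ≠ gapRadius k := by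
  have h2k : 0 < (2 : ℝ) ^ k := zpow_pos two_pos _
  unfold zoomScale gapRadius
  rcases lt_or_ge lam ((2 : ℝ) ^ k) with hlt | hge
  · -- below the scale: strictly smaller
    refine ne_of_lt ?_
    have h1 : Real.sqrt (weight lam) < Real.sqrt (3 / 4 * (2 : ℝ) ^ k) :=
      Real.sqrt_lt_sqrt (weight_pos hlam).le (weight_lt_of_lt_zpow hlam hlt)
    exact mul_lt_mul'' hlt h1 hlam.le (Real.sqrt_nonneg _)
  · -- from the scale on: strictly larger
    refine ne_of_gt ?_
    have h1 : (2 : ℝ) ^ k ≤ weight lam := by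
      rcases eq_or_lt_of_le hge with heq | hgt
      · rw [← heq, weight_zpow]
      · rw [← weight_zpow k]
        exact (weight_strictMonoOn h2k hlam hgt).le
    have h2 : Real.sqrt (3 / 4 * (2 : ℝ) ^ k) < Real.sqrt (weight lam) :=
      Real.sqrt_lt_sqrt (by positivity) (by linarith)
    calc (2 : ℝ) ^ k * Real.sqrt (3 / 4 * (2 : ℝ) ^ k)
        < (2 : ℝ) ^ k * Real.sqrt (weight lam) := mul_lt_mul_of_pos_left h2 h2k
      _ ≤ lam * Real.sqrt (weight lam) := mul_le_mul_of_nonneg_right hge (Real.sqrt_nonneg _)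

/-! ### The rate `g`: `f(λ)^{E}` on the range of `φ`, `r^{-4}` off it -/

/-- The rate function: `g(φ(λ)) = f(λ)^E` on the range of `φ` (so that (2.4) holds as soon as
`E > e`) and `g(r) = r^{-4}` off the range (where (2.4) says nothing). [folklore] -/
def badRate (E r : ℝ) : ℝ :=
  @dite ℝ (∃ lam ∈ Ioi (0 : ℝ), zoomScale lam = r) (Classical.dec _)
    (fun h => weight (Classical.choose h) ^ E) (fun _ => r ^ (-(4 : ℝ)))

/-- `g > 0` on `]0, ∞[`. [folklore] -/
private theorem badRate_pos (E : ℝ) {r : ℝ} (hr : 0 < r) : 0 < badRate E r := by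
  unfold badRate
  split_ifs with h
  · exact Real.rpow_pos_of_pos (weight_pos (Classical.choose_spec h).1) E
  · exact Real.rpow_pos_of_pos hr _

/-- On the range of `φ`: `g(φ(λ)) = f(λ)^E` (`φ` is injective on `]0, ∞[`). [folklore] -/
private theorem badRate_zoomScale (E : ℝ) {lam : ℝ} (hlam : 0 < lam) :
    badRate E (zoomScale lam) = weight lam ^ E := by
  have h : ∃ mu ∈ Ioi (0 : ℝ), zoomScale mu = zoomScale lam := ⟨lam, hlam, rfl⟩
  unfold badRate
  rw [dif_pos h]
  have hspec := Classical.choose_spec h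
  have heq : Classical.choose h = lam := zoomScale_strictMonoOn.injOn hspec.1 hlam hspec.2
  rw [heq]

/-- Off the range of `φ`, at the gap radii: `g(a_k) = a_k^{-4}`. [folklore] -/
private theorem badRate_gapRadius (E : ℝ) (k : ℤ) : badRate E (gapRadius k) = gapRadius k ^ (-(4 : ℝ)) := by
  unfold badRate
  rw [dif_neg]
  rintro ⟨lam, hlam, heq⟩
  exact zoomScale_ne_gapRadius hlam k heq

/-! ### The constant flow -/

/-- A constant velocity with zero pressure is a suitable weak solution of the unforced
Navier–Stokes system (`ν = 1`) on every open region (every term of the equation vanishes).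
[cite: CaffarelliKohnNirenberg1982, §2 (2.1)–(2.5)] -/
theorem isSuitableWeakSolutionOn_const (Q : Opens (ℝ × EuclideanSpace ℝ (Fin 3)))
    (c : EuclideanSpace ℝ (Fin 3)) :
    IsSuitableWeakSolutionOn Q 1 0 (fun (_ : ℝ) (_ : EuclideanSpace ℝ (Fin 3)) => c)
      (fun (_ : ℝ) (_ : EuclideanSpace ℝ (Fin 3)) => (0 : ℝ)) := by
  have hQ : (Q : Set (ℝ × EuclideanSpace ℝ (Fin 3))) ⊆ (univ : Set ℝ) ×ˢ univ :=
    fun z _ => ⟨mem_univ _, mem_univ _⟩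
  have hu0 : uncurry (fun (_ : ℝ) (_ : EuclideanSpace ℝ (Fin 3)) => c) = fun _ => c := rfl
  have hp0 : uncurry (fun (_ : ℝ) (_ : EuclideanSpace ℝ (Fin 3)) => (0 : ℝ)) = fun _ => 0 := rfl
  have hf0 : uncurry (0 : ℝ → EuclideanSpace ℝ (Fin 3) → EuclideanSpace ℝ (Fin 3)) = fun _ => 0 := rfl
  refine isSuitableWeakSolutionOn_of_contDiffOn (S := univ) isOpen_univ hQ ?_ ?_ ?_ ?_ ?_
  · rw [hu0]; exact contDiffOn_const
  · rw [hp0]; exact contDiffOn_const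
  · rw [hf0]; exact continuousOn_const
  · intro t _ x
    have h1 : timeDeriv (fun (_ : ℝ) (_ : EuclideanSpace ℝ (Fin 3)) => c) t x = 0 := by
      simp [timeDeriv]
    have h2 : convect (fun _ : EuclideanSpace ℝ (Fin 3) => c) (fun _ => c) x = 0 := by
      simp [convect]
    have h3 : (Δ (fun _ : EuclideanSpace ℝ (Fin 3) => c)) x = 0 := by simp
    have h4 : gradient (fun _ : EuclideanSpace ℝ (Fin 3) => (0 : ℝ)) x = 0 := gradient_fun_const x 0
    rw [h1, h2, h3, h4]
    simp
  · intro t _ x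
    simp [VectorCalculus.divergence]

/-- A constant field has the weak spatial gradient `0`. [cite: CaffarelliKohnNirenberg1982, §2 (2.1)] -/
theorem hasWeakSpatialGradientOn_const (Q : Opens (ℝ × EuclideanSpace ℝ (Fin 3)))
    (c : EuclideanSpace ℝ (Fin 3)) :
    HasWeakSpatialGradientOn Q (fun (_ : ℝ) (_ : EuclideanSpace ℝ (Fin 3)) => c) 0 := by
  have hQ : (Q : Set (ℝ × EuclideanSpace ℝ (Fin 3))) ⊆ (univ : Set ℝ) ×ˢ univ :=
    fun z _ => ⟨mem_univ _, mem_univ _⟩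
  have hu0 : uncurry (fun (_ : ℝ) (_ : EuclideanSpace ℝ (Fin 3)) => c) = fun _ => c := rfl
  have h := hasWeakSpatialGradientOn_of_contDiffOn (Q := Q) (u := fun (_ : ℝ) (_ : EuclideanSpace ℝ (Fin 3)) => c)
    isOpen_univ hQ (by rw [hu0]; exact contDiffOn_const)
  have e : (fun (_ : ℝ) (x : EuclideanSpace ℝ (Fin 3)) => fderiv ℝ (fun _ : EuclideanSpace ℝ (Fin 3) => c) x) =
      (0 : ℝ → EuclideanSpace ℝ (Fin 3) → EuclideanSpace ℝ (Fin 3) →L[ℝ] EuclideanSpace ℝ (Fin 3)) := by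
    funext t x
    simp
  rw [← e]
  exact h

/-- The constant flow `(c, 0)` is a suitable weak solution in the unit parabolic ball in the class
of Albritton–Barker's Def. 2.1 (`IsSuitableWeakSolutionInBall`). [cite: AlbrittonBarker2019, Def. 2.1] -/
theorem isSuitableWeakSolutionInBall_const (c : EuclideanSpace ℝ (Fin 3)) :
    IsSuitableWeakSolutionInBall 1 0 (fun (_ : ℝ) (_ : EuclideanSpace ℝ (Fin 3)) => c)
      (fun (_ : ℝ) (_ : EuclideanSpace ℝ (Fin 3)) => (0 : ℝ)) := by
  refine ⟨isSuitableWeakSolutionOn_const _ c, ?_, ⟨0, hasWeakSpatialGradientOn_const _ c, ?_⟩, ?_⟩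
  · refine ⟨(‖c‖ₑ ^ 2 * volume (ball (0 : EuclideanSpace ℝ (Fin 3)) 1)).toNNReal,
      Eventually.of_forall fun t => ?_⟩
    rw [setLIntegral_const, Prod.snd_zero,
      ENNReal.coe_toNNReal (ENNReal.mul_ne_top (by simp) measure_ball_lt_top.ne)]
  · simp [frobeniusNormSq_zero]
  · have : uncurry (fun (_ : ℝ) (_ : EuclideanSpace ℝ (Fin 3)) => (0 : ℝ)) = 0 := rfl
    rw [this]
    exact MemLp.zero

/-- The weighted bound (1.7) for the constant flow: `A_f(c, r) = f(r)² r² |B₁| |c|² ≤ |B₁| |c|²`,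
`E_f = D_f = 0`. [cite: Seregin2026, (1.7) (p. 4)] -/
theorem hasWeightedEnergyBound_const (c : EuclideanSpace ℝ (Fin 3)) :
    HasWeightedEnergyBound weight
      (‖c‖ₑ ^ 2 * volume (ball (0 : EuclideanSpace ℝ (Fin 3)) 1)).toNNReal
      (fun (_ : ℝ) (_ : EuclideanSpace ℝ (Fin 3)) => c)
      (fun (_ : ℝ) (_ : EuclideanSpace ℝ (Fin 3)) => (0 : ℝ)) 0 := by
  intro r hr
  have hr0 : 0 < r := hr.1
  have hM : ((‖c‖ₑ ^ 2 * volume (ball (0 : EuclideanSpace ℝ (Fin 3)) 1)).toNNReal : ℝ≥0∞) = ‖c‖ₑ ^ 2 * volume (ball (0 : EuclideanSpace ℝ (Fin 3)) 1) :=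
    ENNReal.coe_toNNReal (ENNReal.mul_ne_top (by simp) measure_ball_lt_top.ne)
  -- `E_f = 0`, `D_f = 0`
  have hE : weightedE weight r (0 : ℝ × EuclideanSpace ℝ (Fin 3))
      (0 : ℝ → EuclideanSpace ℝ (Fin 3) → EuclideanSpace ℝ (Fin 3) →L[ℝ] EuclideanSpace ℝ (Fin 3)) = 0 := by
    unfold weightedE
    simp [frobeniusNormSq_zero]
  have hD : weightedD weight r (0 : ℝ × EuclideanSpace ℝ (Fin 3))
      (fun (_ : ℝ) (_ : EuclideanSpace ℝ (Fin 3)) => (0 : ℝ)) = 0 := by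
    unfold weightedD
    simp only [enorm_zero]
    rw [ENNReal.zero_rpow_of_pos (by norm_num), lintegral_zero, mul_zero]
  -- `A_f ≤ |B₁| |c|²`
  have hw : weight r ^ 2 / r ≤ 1 := by
    have h1 := weight_le_self hr0
    have h2 := (weight_pos hr0).le
    rw [div_le_one hr0]
    nlinarith [hr.2]
  have hA : weightedA weight r (0 : ℝ × EuclideanSpace ℝ (Fin 3))
      (fun (_ : ℝ) (_ : EuclideanSpace ℝ (Fin 3)) => c) ≤ ‖c‖ₑ ^ 2 * volume (ball (0 : EuclideanSpace ℝ (Fin 3)) 1) := by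
    unfold weightedA
    refine essSup_le_of_ae_le _ (Eventually.of_forall fun t => ?_)
    show ENNReal.ofReal (weight r ^ 2 / r) *
        ∫⁻ x in ball (0 : ℝ × EuclideanSpace ℝ (Fin 3)).2 r, ‖c‖ₑ ^ 2 ≤ ‖c‖ₑ ^ 2 * volume (ball (0 : EuclideanSpace ℝ (Fin 3)) 1)
    rw [setLIntegral_const, Prod.snd_zero]
    calc ENNReal.ofReal (weight r ^ 2 / r) * (‖c‖ₑ ^ 2 * volume (ball (0 : EuclideanSpace ℝ (Fin 3)) r))
        ≤ ENNReal.ofReal 1 * (‖c‖ₑ ^ 2 * volume (ball (0 : EuclideanSpace ℝ (Fin 3)) 1)) := by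
          exact mul_le_mul' (ENNReal.ofReal_le_ofReal hw) (mul_le_mul_right (measure_mono
            (ball_subset_ball (x := (0 : EuclideanSpace ℝ (Fin 3))) hr.2.le)) _)
      _ = ‖c‖ₑ ^ 2 * volume (ball (0 : EuclideanSpace ℝ (Fin 3)) 1) := by rw [ENNReal.ofReal_one, one_mul]
  rw [hE, hD, add_zero, add_zero, hM]
  exact hA

/-- `M^{3,3}_2` of a constant field: `M^{3,3}_2(c, r) = |c|³ |B(0,r)|` (`r > 0`).
[cite: Seregin2026, §1 p. 3 (definition of `M^{s,l}_κ`)] -/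
theorem morreyM_const (c : EuclideanSpace ℝ (Fin 3)) {r : ℝ} (hr : 0 < r) :
    morreyM 2 3 3 (0 : ℝ × EuclideanSpace ℝ (Fin 3)) (fun (_ : ℝ) (_ : EuclideanSpace ℝ (Fin 3)) => c) r =
      ‖c‖ₑ ^ (3 : ℝ) * volume (ball (0 : EuclideanSpace ℝ (Fin 3)) r) := by
  unfold morreyM
  rw [Prod.fst_zero, Prod.snd_zero, zero_sub, setLIntegral_const,
    show ((3 : ℝ) / 3) = 1 by norm_num, ENNReal.rpow_one, setLIntegral_const, Real.volume_Ioo,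
    show (0 : ℝ) - -r ^ 2 = r ^ 2 by ring]
  have hK : ENNReal.ofReal (r ^ (-(2 : ℝ))) * ENNReal.ofReal (r ^ 2) = 1 := by
    rw [← ENNReal.ofReal_mul (by positivity), Real.rpow_neg hr.le, ← Real.rpow_natCast r 2]
    push_cast
    rw [inv_mul_cancel₀ (Real.rpow_pos_of_pos hr 2).ne', ENNReal.ofReal_one]
  calc ENNReal.ofReal (r ^ (-(2 : ℝ))) *
        (‖c‖ₑ ^ (3 : ℝ) * volume (ball (0 : EuclideanSpace ℝ (Fin 3)) r) * ENNReal.ofReal (r ^ 2))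
      = ENNReal.ofReal (r ^ (-(2 : ℝ))) * ENNReal.ofReal (r ^ 2) *
          (‖c‖ₑ ^ (3 : ℝ) * volume (ball (0 : EuclideanSpace ℝ (Fin 3)) r)) := by ring
    _ = _ := by rw [hK, one_mul]

/-! ### The gap radii as a null sequence in `]0,1[` -/

/-- `2^{-(n+1)} = (1/2)^{n+1}`. [folklore] -/
private theorem two_zpow_neg_succ (n : ℕ) : (2 : ℝ) ^ (-(n : ℤ) - 1) = (1 / 2) ^ (n + 1) := by
  rw [show (-(n : ℤ) - 1) = -((n + 1 : ℕ) : ℤ) by push_cast; ring, zpow_neg, zpow_natCast,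
    one_div, inv_pow]

/-- `a_k ≤ 2^k` for `k ≤ 0`. [folklore] -/
private theorem gapRadius_le_zpow {k : ℤ} (hk : k ≤ 0) : gapRadius k ≤ (2 : ℝ) ^ k := by
  unfold gapRadius
  have h2k : 0 < (2 : ℝ) ^ k := zpow_pos two_pos _
  have h1 : (2 : ℝ) ^ k ≤ 1 := zpow_le_one_of_nonpos₀ one_le_two hk
  have h3 : Real.sqrt (3 / 4 * (2 : ℝ) ^ k) ≤ 1 := by
    rw [← Real.sqrt_one]
    exact Real.sqrt_le_sqrt (by nlinarith)
  exact mul_le_of_le_one_right h2k.le h3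

/-- `a_{-(n+1)} ∈ ]0, 1[`. [folklore] -/
private theorem gapRadius_mem_Ioo (n : ℕ) : gapRadius (-(n : ℤ) - 1) ∈ Ioo (0 : ℝ) 1 := by
  refine ⟨gapRadius_pos _, ?_⟩
  have h := gapRadius_le_zpow (k := -(n : ℤ) - 1) (by omega)
  rw [two_zpow_neg_succ] at h
  have h2 : (1 / 2 : ℝ) ^ (n + 1) < 1 := pow_lt_one₀ (by norm_num) (by norm_num) (by omega)
  exact h.trans_lt h2

/-- `a_{-(n+1)} → 0⁺`. [folklore] -/
private theorem tendsto_gapRadius : Tendsto (fun n : ℕ => gapRadius (-(n : ℤ) - 1)) atTop (𝓝[>] 0) := by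
  refine tendsto_nhdsWithin_iff.2 ⟨?_, Eventually.of_forall fun n => gapRadius_pos _⟩
  have hgeo : Tendsto (fun n : ℕ => (1 / 2 : ℝ) ^ (n + 1)) atTop (𝓝 0) :=
    (tendsto_pow_atTop_nhds_zero_of_lt_one (by norm_num) (by norm_num)).comp (tendsto_add_atTop_nat 1)
  refine squeeze_zero (fun n => (gapRadius_pos _).le) (fun n => ?_) hgeo
  have h := gapRadius_le_zpow (k := -(n : ℤ) - 1) (by omega)
  rwa [two_zpow_neg_succ] at h

/-! ### The refutation -/

/-- **Counterexample to the typed rendering of [Seregin2026] Thm 2.1** (all hypotheses of the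
named fact `seregin2026_typeII_scenario_excluded` hold and its conclusion fails), written out in
full: the constant flow `(c, 0)` in `Q`, the jumpy scenario weight `f(λ) = (λ + 2^{⌊log₂λ⌋})/2`,
the rate `g` equal to `f(λ)^{e+1}` at `r = λ√f(λ)` and to `r^{-4}` elsewhere, `(s, l, η) = (3,3,0)`:
(2.4) reads `f(λ)^{-1} → ∞`, while at the gap radii `a_n → 0` of the range of `λ ↦ λ√f(λ)` one has
`g(a_n) M^{3,3}_2(c, a_n) = |B₁| a_n^{-1} ≥ |B₁| > 0`, so (2.5) fails. The printed proof (p. 6)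
inverts `λ ↦ λ√f(λ)`, which requires `f` continuous; see `TypeIIScenarioExcluded.lean` for the
theorem with that hypothesis, proved. [cite: Seregin2026, Thm 2.1 (p. 5), (2.2)–(2.5), proof p. 6] -/
theorem exists_scenario_hypotheses_not_tendsto :
    ∃ (v : ℝ → EuclideanSpace ℝ (Fin 3) → EuclideanSpace ℝ (Fin 3))
      (q : ℝ → EuclideanSpace ℝ (Fin 3) → ℝ)
      (G : ℝ → EuclideanSpace ℝ (Fin 3) → EuclideanSpace ℝ (Fin 3) →L[ℝ] EuclideanSpace ℝ (Fin 3))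
      (f F g : ℝ → ℝ) (s l η : ℝ),
      IsSuitableWeakSolutionInBall 1 0 v q ∧
      HasWeakSpatialGradientOn (parabolicCylinderOpens 1 (0 : ℝ × EuclideanSpace ℝ (Fin 3))) v G ∧
      IsScenarioWeight f F ∧
      (∃ M₁ : ℝ≥0, HasWeightedEnergyBound f M₁ v q G) ∧
      (∀ r ∈ Ioo (0 : ℝ) 1, 0 < g r) ∧
      1 < s ∧ 1 < l ∧ 0 < kappa s l ∧ kappa s l < l ∧
      η ∈ Icc (0 : ℝ) 1 ∧ s < pEta η ∧ l < qEta η ∧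
      Tendsto
        (fun lam : ℝ =>
          f lam ^ (l / 2 * (1 + 3 / s) - 3 / 2 * (1 - s / pEta η) * (l / s)) *
            (g (lam * Real.sqrt (f lam)))⁻¹)
        (𝓝[>] 0) atTop ∧
      ¬ Tendsto
        (fun r : ℝ =>
          ENNReal.ofReal (g r) * morreyM (kappa s l) s l (0 : ℝ × EuclideanSpace ℝ (Fin 3)) v r)
        (𝓝[>] 0) (𝓝 0) := by
  obtain ⟨c, hc⟩ := exists_norm_eq (EuclideanSpace ℝ (Fin 3)) zero_le_one
  have hce : ‖c‖ₑ = 1 := by rw [← ofReal_norm, hc, ENNReal.ofReal_one]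
  set E₀ : ℝ := (3 : ℝ) / 2 * (1 + 3 / 3) - 3 / 2 * (1 - 3 / pEta 0) * (3 / 3) with hE₀
  have hκ : 0 < kappa 3 3 := by rw [kappa_three_three]; norm_num
  have hκl : kappa 3 3 < 3 := by rw [kappa_three_three]; norm_num
  have h3p : (3 : ℝ) < pEta 0 := by rw [pEta_zero]; norm_num
  have h3q : (3 : ℝ) < qEta 0 := by rw [qEta_zero]; norm_num
  refine ⟨fun _ _ => c, fun _ _ => 0, 0, weight, _, badRate (E₀ + 1), 3, 3, 0,
    isSuitableWeakSolutionInBall_const c, hasWeakSpatialGradientOn_const _ c, isScenarioWeight_weight,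
    ⟨_, hasWeightedEnergyBound_const c⟩, fun r hr => badRate_pos _ hr.1, by norm_num, by norm_num,
    hκ, hκl, ⟨le_rfl, zero_le_one⟩, h3p, h3q, ?_, ?_⟩
  · -- (2.4): on the range of `λ ↦ λ√f(λ)` the rate is `f^{e+1}`, so the expression is `f(λ)⁻¹ → ∞`
    have hw : Tendsto weight (𝓝[>] 0) (𝓝[>] 0) :=
      tendsto_nhdsWithin_iff.2 ⟨isScenarioWeight_weight.tendsto_zero,
        mem_of_superset self_mem_nhdsWithin fun lam hlam => weight_pos hlam⟩
    refine (tendsto_inv_nhdsGT_zero.comp hw).congr' ?_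
    filter_upwards [self_mem_nhdsWithin] with lam hlam
    have hlam' : 0 < lam := hlam
    have hb := badRate_zoomScale (E₀ + 1) hlam'
    unfold zoomScale at hb
    have hwp : 0 < weight lam := weight_pos hlam'
    rw [comp_apply, hb, Real.rpow_add_one hwp.ne', mul_inv, ← mul_assoc,
      mul_inv_cancel₀ (Real.rpow_pos_of_pos hwp _).ne', one_mul]
  · -- (2.5) fails along the gap radii
    intro hT
    simp only [kappa_three_three] at hT
    have hlim := hT.comp tendsto_gapRadius
    have hB1 : 0 < volume (ball (0 : EuclideanSpace ℝ (Fin 3)) 1) := measure_ball_pos volume _ one_pos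
    have hge : ∀ n : ℕ, volume (ball (0 : EuclideanSpace ℝ (Fin 3)) 1) ≤
        ENNReal.ofReal (badRate (E₀ + 1) (gapRadius (-(n : ℤ) - 1))) *
          morreyM 2 3 3 (0 : ℝ × EuclideanSpace ℝ (Fin 3)) (fun (_ : ℝ) (_ : EuclideanSpace ℝ (Fin 3)) => c)
            (gapRadius (-(n : ℤ) - 1)) := by
      intro n
      have ha := gapRadius_mem_Ioo n
      set a : ℝ := gapRadius (-(n : ℤ) - 1) with hadef
      rw [badRate_gapRadius, ← hadef, morreyM_const c ha.1, hce, ENNReal.one_rpow, one_mul,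
        Measure.addHaar_ball volume (0 : EuclideanSpace ℝ (Fin 3)) ha.1.le, finrank_euclideanSpace_fin,
        ← mul_assoc, ← ENNReal.ofReal_mul (Real.rpow_nonneg ha.1.le _)]
      have hexp : a ^ (-(4 : ℝ)) * a ^ 3 = a⁻¹ := by
        rw [← Real.rpow_natCast a 3, ← Real.rpow_add ha.1, ← Real.rpow_neg_one]
        norm_num
      rw [hexp]
      have h1 : (1 : ℝ) ≤ a⁻¹ := one_le_inv₀ ha.1 |>.2 ha.2.le
      calc volume (ball (0 : EuclideanSpace ℝ (Fin 3)) 1)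
          = ENNReal.ofReal 1 * volume (ball (0 : EuclideanSpace ℝ (Fin 3)) 1) := by
            rw [ENNReal.ofReal_one, one_mul]
        _ ≤ ENNReal.ofReal a⁻¹ * volume (ball (0 : EuclideanSpace ℝ (Fin 3)) 1) := by
            gcongr
    have hle := ge_of_tendsto' hlim hge
    exact absurd hle (not_le.2 hB1)

/-- **The named fact `seregin2026_typeII_scenario_excluded`, as typed, is false.**
[cite: Seregin2026, Thm 2.1 (p. 5), proof p. 6] -/
theorem not_seregin2026_typeII_scenario_excluded : ¬ seregin2026_typeII_scenario_excluded := by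
  intro h
  obtain ⟨v, q, G, f, F, g, s, l, η, hv, hG, hfF, hb, hg, hs, hl, hκ, hκl, hη, hsp, hlq, h24, hnot⟩ :=
    exists_scenario_hypotheses_not_tendsto
  exact hnot (h v q G f F g s l η hv hG hfF hb hg hs hl hκ hκl hη hsp hlq h24)

end TypeIIScenarioCounterexample

end Literature.Analysis.FluidPDE.Seregin2023

end
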